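import Summits.ValiantsHypothesis.ValiantsHypothesis.Theorems.KPlusLogSqLawTropicalOrbitShapes
import Summits.ValiantsHypothesis.ValiantsHypothesis.Theorems.KPlusLogSqLawTropicalOrbitRulesThree

/-!
# Tropical census, symmetric `3 × 3` designs — the pairwise orbit rules M / S / R1w / R1′w / R2w / R2′w / R3w / R3′w HYPOTHESIS-FREE
# (hybrid presence and «outside the orbit» discharged from the two orbit-dominant terms)

HONEST FRAMING.  Helper file (seat val-sym-lift-p2 (g6), cell `pub-symmetroid`, 2026-08-27; `--supports` the `WeakLifting` item
stmt-ValiantsHypothesis-19561 as a helper, no closure claim).  Pure lemma file in the orbit-carrier model (`…TropicalOrbitDominance`,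
`…OrbitExchange`, `…OrbitRules`, `…OrbitRulesThree`: theory g23 / typer g10–g11; shapes `…OrbitShapes`, this seat): the rule lemmas of the
tree take the PRESENCE of their hybrid terms and their position OUTSIDE the two orbits as hypotheses («routine, left to the porter», method
memo `HOME/theory/g23/method/TSYM34-METHOD-g23.md` §4 (a)); here they are discharged once and for all for SYMMETRIC `3 × 3` designs, so that a
port of the orbit row `TSymOrb34Le17` (blueprint: `HOME/val-sym-lift-p2/g6/LEMMA-Z-liftp2g6.md` §6) can quote chain-level rules directly:
* `chain_M`  — two orbit-dominant terms reading the same cell (or transposed cells) at `θa < θb` carry non-decreasing exponents there;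
* `chain_R1` / `chain_R1'` — identity term vs cycle-constant transposition term: `d(λ i) + d(λ j) < 2·d(b)` resp. `>`;
* `chain_R3` / `chain_R3'` — identity term vs pair carrier (3-cycle `σ`, `σ i = j`): `d(λ i) + d(λ j) < 2·d(ν i)` resp. `>`;
* `chain_R2` / `chain_R2'` — cycle-constant transposition `(swap i j, μ)` vs pair carrier: `d(μ k) + d(μ i) < d(ν j) + d(ν k)` resp. `>`;
* `chain_S`  — terms in different orbits have strictly increasing exponent sums.
Every hybrid uses only letters of the two dominant orbits (present), and lies outside an orbit because orbit-dominant terms of symmetric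
designs are transpose-fixed unless they are pair carriers (`isOrbitDominant_symm_three_shape`).  Nothing here is a census numeral: tropical
objects bound no real pencil; `TSymOrb34Le17` / `TSymOrb34Le16` stay targets (NOT asserted); ζ_sym(3,4) ∈ {18,19}, DoorA34 = `PosRootLawAt 3 4 18`
(stmt-ValiantsHypothesis-19980), DoorA26 (stmt-19979) untouched (OPEN, typed, never asserted); nothing on `TropicalB` / `WeakLifting` as closed,
on `MatrixDescartes` (stmt-ValiantsHypothesis-18050) or on VP ≠ VNP.  [folklore] (two-point exchange bookkeeping)
-/

-- `Summit.ValiantsHypothesis.ValiantsHypothesis.…` is the tree's mandated single-conjunct layout (Sub = Summit).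
set_option linter.dupNamespace false
set_option autoImplicit false

namespace Summit.ValiantsHypothesis.ValiantsHypothesis.Theorems.LacunarySymmetroidMatrixDescartes.TropicalCensus.Orbit

open Summit.ValiantsHypothesis.ValiantsHypothesis.Theorems.MatrixDescartes.Negative
open Summit.ValiantsHypothesis.ValiantsHypothesis.Theorems.LacunarySymmetroidMatrixDescartes
open Summit.ValiantsHypothesis.ValiantsHypothesis.Theorems.LacunarySymmetroidMatrixDescartes.TropicalCensus
open Finset

variable {K : ℕ}

/-! ## Orbit bookkeeping -/

/-- transposition is an involution on terms. [folklore] -/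
theorem transposeTerm_transposeTerm {m : ℕ} (p : Equiv.Perm (Fin m) × (Fin m → Fin K)) : transposeTerm (transposeTerm p) = p := by
  obtain ⟨σ, ξ⟩ := p
  simp [transposeTerm]

/-- a fixed-point-free permutation of `Fin 3` is not an involution. -/
theorem inv_ne_self_of_fixedPointFree : ∀ σ : Equiv.Perm (Fin 3), (∀ i, σ i ≠ i) → σ⁻¹ ≠ σ := by decide

/-- in `Fin 3`, every element is one of three pairwise distinct ones. -/
theorem fin3_cases : ∀ i j k x : Fin 3, i ≠ j → k ≠ i → k ≠ j → x = i ∨ x = j ∨ x = k := by decide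

/-- **An orbit-dominant term of a symmetric `3 × 3` design is transpose-fixed or has a carrier different from its inverse.** [shapes] -/
theorem transposeTerm_eq_or_fst_ne (d : Fin K → ℕ) (v ε : Fin 3 → Fin 3 → Fin K → ℤ)
    (hv : ∀ i j l, v i j l = v j i l) (hε : ∀ i j l, ε i j l = ε j i l) {θ : ℤ}
    (σ : Equiv.Perm (Fin 3)) (ξ : Fin 3 → Fin K) (h : IsOrbitDominant d v ε θ (σ, ξ)) :
    transposeTerm (σ, ξ) = (σ, ξ) ∨ σ⁻¹ ≠ σ := by
  rcases isOrbitDominant_symm_three_shape d v ε hv hε σ ξ h with h1 | ⟨i, j, _, hs, hc⟩ | h3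
  · subst h1; left; simp [transposeTerm]
  · subst hs; left
    simp only [transposeTerm, Equiv.swap_inv, Prod.mk.injEq, true_and]
    funext l
    by_cases hi : l = i
    · subst hi; rw [Equiv.swap_apply_left, hc]
    · by_cases hj : l = j
      · subst hj; rw [Equiv.swap_apply_right, hc]
      · rw [Equiv.swap_apply_of_ne_of_ne hi hj]
  · exact Or.inr (inv_ne_self_of_fixedPointFree σ h3)

/-- a letter change of an orbit-dominant term of a symmetric `3 × 3` design leaves the orbit. [shapes] -/
theorem letterChange_ne_transposeTerm (d : Fin K → ℕ) (v ε : Fin 3 → Fin 3 → Fin K → ℤ)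
    (hv : ∀ i j l, v i j l = v j i l) (hε : ∀ i j l, ε i j l = ε j i l) {θ : ℤ}
    (σ : Equiv.Perm (Fin 3)) (ξ ξ' : Fin 3 → Fin K) (h : IsOrbitDominant d v ε θ (σ, ξ)) (hne : ξ' ≠ ξ) :
    ((σ, ξ') : Equiv.Perm (Fin 3) × (Fin 3 → Fin K)) ≠ transposeTerm (σ, ξ) := by
  rcases transposeTerm_eq_or_fst_ne d v ε hv hε σ ξ h with h1 | h2
  · rw [h1]; exact fun hq => hne (congrArg Prod.snd hq)
  · exact fun hq => h2 (by have := congrArg Prod.fst hq; simpa [transposeTerm] using this.symm)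

/-! ## Rule M, hypothesis-free -/

/-- **Rule M along a chain** (symmetric `3 × 3` design): if `(σ, ξ)` is orbit-dominant at `θa` and `(τ, υ)` at `θb > θa`, and column `l₁`
of the first and column `l₂` of the second read the same cell — or transposed cells — then the exponent there does not decrease:
`ξ l₁ ≠ υ l₂ → d (ξ l₁) < d (υ l₂)`. [rule_M_orbit with its side conditions discharged] -/
theorem chain_M (d : Fin K → ℕ) (v ε : Fin 3 → Fin 3 → Fin K → ℤ) (hv : ∀ i j l, v i j l = v j i l) (hε : ∀ i j l, ε i j l = ε j i l)
    {θa θb : ℤ} (hθ : θa < θb) (σ τ : Equiv.Perm (Fin 3)) (ξ υ : Fin 3 → Fin K) (l₁ l₂ : Fin 3)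
    (hcell : (σ l₁ = τ l₂ ∧ l₁ = l₂) ∨ (σ l₁ = l₂ ∧ τ l₂ = l₁))
    (hX : IsOrbitDominant d v ε θa (σ, ξ)) (hY : IsOrbitDominant d v ε θb (τ, υ)) (hne : ξ l₁ ≠ υ l₂) : d (ξ l₁) < d (υ l₂) := by
  have pX := present_of_termSign_ne_zero ε (σ, ξ) hX.1
  have pY := present_of_termSign_ne_zero ε (τ, υ) hY.1
  -- the shared cell carries both letters
  have cellXY : ε (σ l₁) l₁ (υ l₂) ≠ 0 := by
    rcases hcell with ⟨h1, h2⟩ | ⟨h1, h2⟩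
    · subst h2; rw [h1]; exact pY l₁
    · rw [h1, hε, ← h2]; exact pY l₂
  have cellYX : ε (τ l₂) l₂ (ξ l₁) ≠ 0 := by
    rcases hcell with ⟨h1, h2⟩ | ⟨h1, h2⟩
    · subst h2; rw [← h1]; exact pX l₁
    · rw [h2, hε, ← h1]; exact pX l₁
  refine rule_M_orbit d v ε hv hθ σ τ ξ υ l₁ l₂ hcell hX hY ?_ ?_ ?_ ?_ hne
  · refine termSign_ne_zero_of_forall ε σ _ fun l => ?_
    by_cases hl : l = l₁
    · subst hl; rw [if_pos rfl]; exact cellXY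
    · rw [if_neg hl]; exact pX l
  · refine letterChange_ne_transposeTerm d v ε hv hε σ ξ _ hX fun hq => ?_
    have := congrFun hq l₁
    rw [if_pos rfl] at this
    exact hne this.symm
  · refine termSign_ne_zero_of_forall ε τ _ fun l => ?_
    by_cases hl : l = l₂
    · subst hl; rw [if_pos rfl]; exact cellYX
    · rw [if_neg hl]; exact pY l
  · refine letterChange_ne_transposeTerm d v ε hv hε τ υ _ hY fun hq => ?_
    have := congrFun hq l₂
    rw [if_pos rfl] at this
    exact hne this

/-! ## Rules R1w / R1′w, hypothesis-free -/

/-- the two D/T hybrids are present. [bookkeeping] -/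
theorem hybrids_DT_present (ε : Fin 3 → Fin 3 → Fin K → ℤ) (i j : Fin 3) (lam μ : Fin 3 → Fin K)
    (hD : termSign ε ((1 : Equiv.Perm (Fin 3)), lam) ≠ 0) (hT : termSign ε (Equiv.swap i j, μ) ≠ 0) :
    termSign ε (Equiv.swap i j, fun l => if l = i ∨ l = j then μ l else lam l) ≠ 0 ∧
      termSign ε ((1 : Equiv.Perm (Fin 3)), fun l => if l = i ∨ l = j then lam l else μ l) ≠ 0 := by
  have pD := present_of_termSign_ne_zero ε (1, lam) hD
  have pT := present_of_termSign_ne_zero ε (Equiv.swap i j, μ) hT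
  refine ⟨termSign_ne_zero_of_forall ε _ _ fun l => ?_, termSign_ne_zero_of_forall ε _ _ fun l => ?_⟩
  · by_cases h : l = i ∨ l = j
    · rw [if_pos h]; exact pT l
    · rw [if_neg h]
      push Not at h
      rw [Equiv.swap_apply_of_ne_of_ne h.1 h.2]
      exact pD l
  · by_cases h : l = i ∨ l = j
    · rw [if_pos h]; exact pD l
    · rw [if_neg h]
      push Not at h
      have := pT l
      rwa [Equiv.swap_apply_of_ne_of_ne h.1 h.2] at this

/-- sum bookkeeping: the D/T hybrid differs from `D` only on the swapped pair. [bookkeeping] -/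
theorem sum_hybrid_pair (d : Fin K → ℕ) {i j : Fin 3} (hij : i ≠ j) (lam μ : Fin 3 → Fin K) :
    ∑ l, (d (if l = i ∨ l = j then μ l else lam l) : ℤ) = ∑ l, (d (lam l) : ℤ) + (d (μ i) + d (μ j)) - (d (lam i) + d (lam j)) := by
  obtain ⟨k, hki, hkj⟩ : ∃ k : Fin 3, k ≠ i ∧ k ≠ j := by
    revert i j; decide
  rw [sum_three hij hki hkj, sum_three hij hki hkj]
  simp [hki, hkj]
  ring

/-- **Rule R1w along a chain**: identity term `(1, λ)` orbit-dominant at `θa`, cycle-constant transposition term `(swap i j, μ)` at `θb > θa`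
⇒ `d(λ i) + d(λ j) < 2·d(μ i)`. [rule_R1w, hybrids discharged] -/
theorem chain_R1 (d : Fin K → ℕ) (v ε : Fin 3 → Fin 3 → Fin K → ℤ) {θa θb : ℤ} (hθ : θa < θb) {i j : Fin 3} (hij : i ≠ j)
    (lam μ : Fin 3 → Fin K) (hμ : μ i = μ j)
    (hD : IsOrbitDominant d v ε θa (1, lam)) (hT : IsOrbitDominant d v ε θb (Equiv.swap i j, μ)) :
    d (lam i) + d (lam j) < 2 * d (μ i) := by
  obtain ⟨h1, h2⟩ := hybrids_DT_present ε i j lam μ hD.1 hT.1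
  have h := rule_R1w d v ε θa θb hθ i j hij lam μ hD hT h1 h2
  rw [sum_hybrid_pair d hij, ← hμ] at h
  have : (d (lam i) : ℤ) + d (lam j) < d (μ i) + d (μ i) := by linarith
  exact_mod_cast (by linarith : (d (lam i) : ℤ) + d (lam j) < 2 * d (μ i))

/-- **Rule R1′w along a chain**: cycle-constant `(swap i j, μ)` at `θa`, identity `(1, λ)` at `θb > θa` ⇒ `2·d(μ i) < d(λ i) + d(λ j)`.
[rule_R1w', hybrids discharged] -/
theorem chain_R1' (d : Fin K → ℕ) (v ε : Fin 3 → Fin 3 → Fin K → ℤ) {θa θb : ℤ} (hθ : θa < θb) {i j : Fin 3} (hij : i ≠ j)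
    (lam μ : Fin 3 → Fin K) (hμ : μ i = μ j)
    (hT : IsOrbitDominant d v ε θa (Equiv.swap i j, μ)) (hD : IsOrbitDominant d v ε θb (1, lam)) :
    2 * d (μ i) < d (lam i) + d (lam j) := by
  obtain ⟨h1, h2⟩ := hybrids_DT_present ε i j lam μ hD.1 hT.1
  have h := rule_R1w' d v ε θa θb hθ i j hij lam μ hT hD h2 h1
  rw [sum_hybrid_pair d hij μ lam, ← hμ] at h
  exact_mod_cast (by linarith : 2 * (d (μ i) : ℤ) < d (lam i) + d (lam j))

/-! ## Different orbits ⇒ increasing exponent sums -/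

/-- **Rule S along a chain**: two orbit-dominant terms in DIFFERENT orbits at `θa < θb` have strictly increasing exponent sums.
[rule_S_orbit; the symmetric side conditions follow from `transposeTerm` being an involution] -/
theorem chain_S (d : Fin K → ℕ) (v ε : Fin 3 → Fin 3 → Fin K → ℤ) {θa θb : ℤ} (hθ : θa < θb)
    (P Q : Equiv.Perm (Fin 3) × (Fin 3 → Fin K)) (hP : IsOrbitDominant d v ε θa P) (hQ : IsOrbitDominant d v ε θb Q)
    (hPQ : P ≠ Q) (hPQt : P ≠ transposeTerm Q) : ∑ l, (d (P.2 l) : ℤ) < ∑ l, (d (Q.2 l) : ℤ) :=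
  rule_S_orbit d v ε hθ P Q hP hQ hPQ.symm (fun h => hPQt (by rw [h, transposeTerm_transposeTerm])) hPQ hPQt

/-! ## Rules R3w / R3′w and R2w / R2′w against the pair carrier, hypothesis-free -/

section ThreeCycle

variable {i j k : Fin 3} (hij : i ≠ j) (hki : k ≠ i) (hkj : k ≠ j)
  (σ : Equiv.Perm (Fin 3)) (hσi : σ i = j) (hσj : σ j = k) (hσk : σ k = i)
include hij hki hkj hσi hσj hσk

/-- the three transposition hybrids of an identity term and a pair carrier are present. [bookkeeping] -/
theorem hybrids_DC_present (ε : Fin 3 → Fin 3 → Fin K → ℤ) (hε : ∀ a b l, ε a b l = ε b a l) (lam ν : Fin 3 → Fin K)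
    (hD : termSign ε ((1 : Equiv.Perm (Fin 3)), lam) ≠ 0) (hC : termSign ε (σ, ν) ≠ 0) :
    termSign ε (Equiv.swap i j, fun l => if l = i ∨ l = j then ν i else lam l) ≠ 0 ∧
      termSign ε (Equiv.swap j k, fun l => if l = j ∨ l = k then ν j else lam l) ≠ 0 ∧
        termSign ε (Equiv.swap i k, fun l => if l = i ∨ l = k then ν k else lam l) ≠ 0 := by
  have pD := present_of_termSign_ne_zero ε (1, lam) hD
  have pC := present_of_termSign_ne_zero ε (σ, ν) hC
  have hjk : j ≠ k := fun h => hkj h.symm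
  have hik : i ≠ k := fun h => hki h.symm
  have ci : ε j i (ν i) ≠ 0 := by have := pC i; rwa [hσi] at this
  have cj : ε k j (ν j) ≠ 0 := by have := pC j; rwa [hσj] at this
  have ck : ε i k (ν k) ≠ 0 := by have := pC k; rwa [hσk] at this
  refine ⟨termSign_ne_zero_of_forall ε _ _ fun l => ?_, termSign_ne_zero_of_forall ε _ _ fun l => ?_,
    termSign_ne_zero_of_forall ε _ _ fun l => ?_⟩
  · rcases fin3_cases i j k l hij hki hkj with rfl | rfl | rfl
    · rw [if_pos (Or.inl rfl), Equiv.swap_apply_left]; exact ci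
    · rw [if_pos (Or.inr rfl), Equiv.swap_apply_right, hε]; exact ci
    · rw [if_neg (not_or.mpr ⟨hki, hkj⟩), Equiv.swap_apply_of_ne_of_ne hki hkj]; exact pD l
  · rcases fin3_cases i j k l hij hki hkj with rfl | rfl | rfl
    · rw [if_neg (not_or.mpr ⟨hij, hik⟩), Equiv.swap_apply_of_ne_of_ne hij hik]; exact pD l
    · rw [if_pos (Or.inl rfl), Equiv.swap_apply_left]; exact cj
    · rw [if_pos (Or.inr rfl), Equiv.swap_apply_right, hε]; exact cj
  · rcases fin3_cases i j k l hij hki hkj with rfl | rfl | rfl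
    · rw [if_pos (Or.inl rfl), Equiv.swap_apply_left, hε]; exact ck
    · rw [if_neg (not_or.mpr ⟨fun h => hij h.symm, hjk⟩), Equiv.swap_apply_of_ne_of_ne (fun h => hij h.symm) hjk]; exact pD l
    · rw [if_pos (Or.inr rfl), Equiv.swap_apply_right]; exact ck

/-- **Rule R3w along a chain**: identity term `(1, λ)` orbit-dominant at `θa`, pair carrier `(σ, ν)` (`σ : i ↦ j ↦ k ↦ i`) at `θb > θa`
⇒ `d(λ i) + d(λ j) < 2·d(ν i)` for the pair `{i, j}` (the other pairs by cyclic relabelling). [rule_R3w, hybrids discharged] -/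
theorem chain_R3 (d : Fin K → ℕ) (v ε : Fin 3 → Fin 3 → Fin K → ℤ) (hv : ∀ a b l, v a b l = v b a l) (hε : ∀ a b l, ε a b l = ε b a l)
    {θa θb : ℤ} (hθ : θa < θb) (lam ν : Fin 3 → Fin K)
    (hD : IsOrbitDominant d v ε θa (1, lam)) (hC : IsOrbitDominant d v ε θb (σ, ν)) :
    (d (lam i) : ℤ) + d (lam j) < 2 * d (ν i) := by
  obtain ⟨h1, h2, h3⟩ := hybrids_DC_present hij hki hkj σ hσi hσj hσk ε hε lam ν hD.1 hC.1
  exact rule_R3w hij hki hkj σ hσi hσj hσk d v ε hv hθ lam ν hD hC h1 h2 h3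

/-- **Rule R3′w along a chain**: pair carrier `(σ, ν)` at `θa`, identity term `(1, λ)` at `θb > θa` ⇒ `2·d(ν i) < d(λ i) + d(λ j)`.
[rule_R3w', hybrids discharged] -/
theorem chain_R3' (d : Fin K → ℕ) (v ε : Fin 3 → Fin 3 → Fin K → ℤ) (hv : ∀ a b l, v a b l = v b a l) (hε : ∀ a b l, ε a b l = ε b a l)
    {θa θb : ℤ} (hθ : θa < θb) (lam ν : Fin 3 → Fin K)
    (hC : IsOrbitDominant d v ε θa (σ, ν)) (hD : IsOrbitDominant d v ε θb (1, lam)) :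
    2 * (d (ν i) : ℤ) < d (lam i) + d (lam j) := by
  obtain ⟨h1, h2, h3⟩ := hybrids_DC_present hij hki hkj σ hσi hσj hσk ε hε lam ν hD.1 hC.1
  exact rule_R3w' hij hki hkj σ hσi hσj hσk d v ε hv hθ lam ν hC hD h1 h2 h3

/-- a cycle-constant transposition term in letter coordinates. [bookkeeping] -/
theorem swap_term_eq (μ : Fin 3 → Fin K) (hμ : μ i = μ j) :
    ((Equiv.swap i j, μ) : Equiv.Perm (Fin 3) × (Fin 3 → Fin K)) =
      (Equiv.swap i j, fun l => if l = i ∨ l = j then μ i else μ k) := by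
  have hfun : μ = fun l => if l = i ∨ l = j then μ i else μ k := by
    funext l
    rcases fin3_cases i j k l hij hki hkj with rfl | rfl | rfl
    · rw [if_pos (Or.inl rfl)]
    · rw [if_pos (Or.inr rfl), hμ]
    · rw [if_neg (not_or.mpr ⟨hki, hkj⟩)]
  exact Prod.ext rfl hfun

/-- the two T/C hybrids are present. [bookkeeping] -/
theorem hybrids_TC_present (ε : Fin 3 → Fin 3 → Fin K → ℤ) (hε : ∀ a b l, ε a b l = ε b a l) (μ ν : Fin 3 → Fin K)
    (hT : termSign ε (Equiv.swap i j, μ) ≠ 0) (hC : termSign ε (σ, ν) ≠ 0) :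
    termSign ε (σ, fun l => if l = i then μ i else ν l) ≠ 0 ∧
      termSign ε (Equiv.swap i j, fun l => if l = i ∨ l = j then ν i else μ k) ≠ 0 := by
  have pT := present_of_termSign_ne_zero ε (Equiv.swap i j, μ) hT
  have pC := present_of_termSign_ne_zero ε (σ, ν) hC
  have ti : ε j i (μ i) ≠ 0 := by have := pT i; rwa [Equiv.swap_apply_left] at this
  have tk : ε k k (μ k) ≠ 0 := by have := pT k; rwa [Equiv.swap_apply_of_ne_of_ne hki hkj] at this
  have ci : ε j i (ν i) ≠ 0 := by have := pC i; rwa [hσi] at this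
  refine ⟨termSign_ne_zero_of_forall ε _ _ fun l => ?_, termSign_ne_zero_of_forall ε _ _ fun l => ?_⟩
  · by_cases hl : l = i
    · subst hl; rw [if_pos rfl, hσi]; exact ti
    · rw [if_neg hl]; exact pC l
  · rcases fin3_cases i j k l hij hki hkj with rfl | rfl | rfl
    · rw [if_pos (Or.inl rfl), Equiv.swap_apply_left]; exact ci
    · rw [if_pos (Or.inr rfl), Equiv.swap_apply_right, hε]; exact ci
    · rw [if_neg (not_or.mpr ⟨hki, hkj⟩), Equiv.swap_apply_of_ne_of_ne hki hkj]; exact tk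

/-- **Rule R2w along a chain**: cycle-constant `(swap i j, μ)` orbit-dominant at `θa`, pair carrier `(σ, ν)` (`σ : i ↦ j ↦ k ↦ i`) at
`θb > θa` ⇒ `d(μ k) + d(μ i) < d(ν j) + d(ν k)` (the two pairs not read by the transposition term). [rule_R2w, hybrids discharged] -/
theorem chain_R2 (d : Fin K → ℕ) (v ε : Fin 3 → Fin 3 → Fin K → ℤ) (hv : ∀ a b l, v a b l = v b a l) (hε : ∀ a b l, ε a b l = ε b a l)
    {θa θb : ℤ} (hθ : θa < θb) (μ ν : Fin 3 → Fin K) (hμ : μ i = μ j)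
    (hT : IsOrbitDominant d v ε θa (Equiv.swap i j, μ)) (hC : IsOrbitDominant d v ε θb (σ, ν)) :
    (d (μ k) : ℤ) + d (μ i) < d (ν j) + d (ν k) := by
  obtain ⟨h1, h2⟩ := hybrids_TC_present hij hki hkj σ hσi hσj hσk ε hε μ ν hT.1 hC.1
  rw [swap_term_eq hij hki hkj σ hσi hσj hσk μ hμ] at hT
  exact rule_R2w hij hki hkj σ hσi hσj hσk d v ε hv hθ (μ k) (μ i) ν hT hC h1 h2

/-- **Rule R2′w along a chain**: pair carrier `(σ, ν)` at `θa`, cycle-constant `(swap i j, μ)` at `θb > θa` ⇒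
`d(ν j) + d(ν k) < d(μ k) + d(μ i)`. [rule_R2w', hybrids discharged] -/
theorem chain_R2' (d : Fin K → ℕ) (v ε : Fin 3 → Fin 3 → Fin K → ℤ) (hv : ∀ a b l, v a b l = v b a l) (hε : ∀ a b l, ε a b l = ε b a l)
    {θa θb : ℤ} (hθ : θa < θb) (μ ν : Fin 3 → Fin K) (hμ : μ i = μ j)
    (hC : IsOrbitDominant d v ε θa (σ, ν)) (hT : IsOrbitDominant d v ε θb (Equiv.swap i j, μ)) :
    (d (ν j) : ℤ) + d (ν k) < d (μ k) + d (μ i) := by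
  obtain ⟨h1, h2⟩ := hybrids_TC_present hij hki hkj σ hσi hσj hσk ε hε μ ν hT.1 hC.1
  rw [swap_term_eq hij hki hkj σ hσi hσj hσk μ hμ] at hT
  exact rule_R2w' hij hki hkj σ hσi hσj hσk d v ε hv hθ (μ k) (μ i) ν hC hT h1 h2

end ThreeCycle

/-! ## Distinct orbits along an alternating orbit chain -/

/-- **Apartness.**  Along a chain of orbit-dominant terms of a SYMMETRIC design at strictly increasing slopes with alternating signs, two
different positions carry terms in DIFFERENT orbits (`p a ≠ p b` and `p a ≠ (p b)ᵀ`): consecutive positions because an orbit has ONE sign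
(`termSign_transpose`), distant ones because the set of slopes where a fixed orbit is dominant is an interval (weights are affine in `θ`,
`tropWeight_transpose`), which would swallow the orbit in between. [folklore; the orbit twin of `stub_dominantInjective`] -/
theorem orbitChain_apart {m : ℕ} (d : Fin K → ℕ) (v ε : Fin m → Fin m → Fin K → ℤ)
    (hv : ∀ i j l, v i j l = v j i l) (hε : ∀ i j l, ε i j l = ε j i l)
    {n : ℕ} (θ : Fin (n + 1) → ℤ) (p : Fin (n + 1) → Equiv.Perm (Fin m) × (Fin m → Fin K))
    (hθ : StrictMono θ) (hdom : ∀ k, IsOrbitDominant d v ε (θ k) (p k))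
    (halt : ∀ k : Fin n, termSign ε (p k.castSucc) * termSign ε (p k.succ) < 0) {a b : Fin (n + 1)} (hab : a < b) :
    p a ≠ p b ∧ p a ≠ transposeTerm (p b) := by
  -- an orbit has one sign and one weight
  have sameSign : ∀ q : Equiv.Perm (Fin m) × (Fin m → Fin K), termSign ε (transposeTerm q) = termSign ε q := fun q =>
    termSign_transpose ε hε q.1 q.2
  have sameW : ∀ (t : ℤ) (q : Equiv.Perm (Fin m) × (Fin m → Fin K)), tropWeight d v t (transposeTerm q) = tropWeight d v t q :=
    fun t q => tropWeight_transpose d v hv t q.1 q.2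
  -- consecutive positions are never in one orbit
  have consec : ∀ (x y : Fin (n + 1)), (y : ℕ) = x + 1 → ¬ (p x = p y ∨ p x = transposeTerm (p y)) := by
    intro x y hxy hs
    have hx : (x : ℕ) < n := by have := y.isLt; omega
    have h := halt ⟨x, hx⟩
    have e1 : (⟨(x : ℕ), hx⟩ : Fin n).castSucc = x := Fin.ext rfl
    have e2 : (⟨(x : ℕ), hx⟩ : Fin n).succ = y := Fin.ext (by simp [hxy])
    rw [e1, e2] at h
    have hsg : termSign ε (p x) = termSign ε (p y) := by
      rcases hs with hs | hs
      · rw [hs]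
      · rw [hs, sameSign]
    rw [hsg] at h
    exact absurd h (not_lt.mpr (mul_self_nonneg _))
  by_contra hcon
  have hs : p a = p b ∨ p a = transposeTerm (p b) := by
    by_contra h'
    exact hcon ⟨fun h => h' (Or.inl h), fun h => h' (Or.inr h)⟩
  have hab' : (a : ℕ) < b := hab
  by_cases hc : (b : ℕ) = a + 1
  · exact consec a b hc hs
  · -- the position `c = a + 1` strictly between
    have hcn : (a : ℕ) + 1 < n + 1 := by have := b.isLt; omega
    set c : Fin (n + 1) := ⟨(a : ℕ) + 1, hcn⟩ with hcdef
    have hac : a < c := by rw [Fin.lt_def]; simp [hcdef]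
    have hcb : c < b := by rw [Fin.lt_def]; simp only [hcdef]; omega
    by_cases hco : p c = p a ∨ p c = transposeTerm (p a)
    · refine consec a c rfl ?_
      rcases hco with h | h
      · exact Or.inl h.symm
      · exact Or.inr (by rw [h, transposeTerm_transposeTerm])
    · push Not at hco
      -- the orbit of `p a` (= orbit of `p b`) beats `p c` at `θ a` and `θ b`, and loses at `θ c`: impossible for affine weights
      have orb_b : p c ≠ p b ∧ p c ≠ transposeTerm (p b) := by
        rcases hs with hs | hs
        · rw [← hs]; exact hco
        · constructor
          · intro h; apply hco.2; rw [hs, transposeTerm_transposeTerm]; exact h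
          · intro h; apply hco.1; rw [h, hs]
      have h1 := (hdom a).2 (p c) hco.1 hco.2 (hdom c).1
      have h2 := (hdom c).2 (p a) (fun h => hco.1 h.symm)
        (fun h => hco.2 (by rw [h, transposeTerm_transposeTerm])) (hdom a).1
      have h3 := (hdom b).2 (p c) orb_b.1 orb_b.2 (hdom c).1
      have hWb : tropWeight d v (θ b) (p b) = tropWeight d v (θ b) (p a) := by
        rcases hs with hs | hs
        · rw [hs]
        · rw [hs, sameW]
      rw [hWb] at h3
      unfold tropWeight at h1 h2 h3
      have t1 := hθ hac
      have t2 := hθ hcb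
      set Sa := ∑ i, (d ((p a).2 i) : ℤ)
      set Sc := ∑ i, (d ((p c).2 i) : ℤ)
      set Va := ∑ i, v ((p a).1 i) i ((p a).2 i)
      set Vc := ∑ i, v ((p c).1 i) i ((p c).2 i)
      have hslope : Sa - Sc < 0 := by
        by_contra hge
        push Not at hge
        have : 0 ≤ (θ c - θ a) * (Sa - Sc) := mul_nonneg (by linarith) hge
        nlinarith
      have : (θ b - θ c) * (Sa - Sc) < 0 := mul_neg_of_pos_of_neg (by linarith) hslope
      nlinarith

end Summit.ValiantsHypothesis.ValiantsHypothesis.Theorems.LacunarySymmetroidMatrixDescartes.TropicalCensus.Orbit
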